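/-
Copyright (c) 2026 the pub-hodgecm-mathlib formalisation cell (harness21).  Prover seat hodgecm-mathlib-K2Liu-p05 (g4), 2026-09-04
(Track B «K2-LIT», crux hLiu418 = stmt-HodgeConjecture-24832, LEAD F0P6-plan (g13) RULING M-157m (1) organ (SD-1-ind), file (V-1):
polynomial moments of Shimura's `ξ`-integrand are REAL `h`-line derivatives of polynomial moments of lower degree).
-/
import Summits.HodgeConjecture.HodgeConjecture.Theorems.K2LiuHermTwoConfluentXiConvergence      -- ★ Φ6b (K2E5-p16): `norm_xiTwoIntegrand_le`, integrability
import Mathlib.Analysis.Calculus.ParametricIntegral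
import Mathlib.Analysis.Calculus.IteratedDeriv.Defs
import Mathlib.Topology.Algebra.MvPolynomial
import HarnessLib

/-!
# (SD-1-ind, V-1) Polynomial moments of `ξ(1, h; A, B)` as real `h`-line derivatives

Track B ∕ K2-LIT, hLiu418 = stmt-HodgeConjecture-24832; LEAD F0P6-plan (g13) RULING M-157m (1).  Namespace
`Summit.HodgeConjecture.HodgeConjecture.Cruxes.HLiu418.K2LiuXiTwoMomentsAsHDerivatives`.  THEOREMS ONLY; `--supports stmt-HodgeConjecture-24832 --as helper`.

For a polynomial weight `P ∈ ℂ[x_{jk}]`, hermitian `h, Θ` and `re(A + B) > 3 + deg P + 1`, the moment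
`M_P(t) = ∫ P(x) · xiTwoIntegrand 1 (h + tΘ) A B (x) dx` (`x = hermTwo c`, `t ∈ ℝ`) is differentiable in the REAL parameter `t` with
`M_P'(t) = M_{P · (−2πi·tr(Θ x))}(t)` (`hasDerivAt_moment`; dominated differentiation, majorant `|x_{jk}| ≤ |det(1 + ix)|`,
`norm_hermTwo_apply_le_norm_det`, and K2E5-p16 (g5)'s ★ `norm_xiTwoIntegrand_le` ∕ `integrable_norm_det_add_I_smul_rpow_neg`); iterating
(`iteratedDeriv_moment`), `(d∕dt)^n M_P = M_{P·(−2πi tr(Θx))^n}` for `re(A+B) > 3 + deg P + n`, in particular (`iteratedDeriv_xiTwo_hLine`)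
  `(d∕dt)^n|_{t} ξ(1, h + tΘ; A, B) = ∫ (−2πi·tr(Θ x))^n · xiTwoIntegrand 1 (h + tΘ) A B (x) dx`.
With ★ (IV-b) `exists_xiTwoIntegrand_moments` and ★ L2 polarization this turns `W_h(s; f)` into a finite combination of real `h`-line derivatives of
`ξ(1, ·; A + m, B + n)` at `h`; the transfer to LEAD's `g`-line letter is (V-2)–(V-4).  Only REAL `t`: `|e(−tr((h + tΘ)x))| = 1` needs `h + tΘ` hermitian.

HONEST LABEL: HC_CM is proved only modulo the 7 printed citations (2 remaining named inputs: hLiu418 = stmt-HodgeConjecture-24832, h413 =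
stmt-HodgeConjecture-24833) until rung 0 closes; organ capital, moves no counter.

## References
[Shimura1997] G. Shimura, *Euler Products and Eisenstein Series*, CBMS 93 (1997), §16 · G. Shimura, Math. Ann. 260 (1982), §3 (differentiation of `ξ` in `h`).
-/

set_option autoImplicit false
set_option linter.dupNamespace false

noncomputable section

open scoped Matrix ComplexConjugate ComplexOrder
open Complex Matrix MeasureTheory
open Summit.HodgeConjecture.HodgeConjecture.Cruxes.HLiu418.K2LiuHermTwoGammaDefs
open Summit.HodgeConjecture.HodgeConjecture.Cruxes.HLiu418.K2LiuHermTwoConfluentXiDefs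
open Summit.HodgeConjecture.HodgeConjecture.Cruxes.HLiu418.K2LiuHermTwoDetPowerIntegrable
open Summit.HodgeConjecture.HodgeConjecture.Cruxes.HLiu418.K2LiuHermTwoConfluentXiConvergence

namespace Summit.HodgeConjecture.HodgeConjecture.Cruxes.HLiu418.K2LiuXiTwoMomentsAsHDerivatives

/-! ## §1 Chart bounds: `1, |a|, |b|, |z| ≤ |det(1 + ix)|` for `x = hermTwo (a, z, b)` -/

/-- `det(1 + i·hermTwo(a, z, b)) = (1 − ab + |z|²) + i(a + b)`. [folklore] -/
theorem det_one_add_I_smul_hermTwo (c : ℝ × ℂ × ℝ) :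
    (1 + I • hermTwo c).det = ((1 - c.1 * c.2.2 + normSq c.2.1 : ℝ) : ℂ) + I * ((c.1 + c.2.2 : ℝ) : ℂ) := by
  rw [det_add_I_smul_hermTwo]
  simp only [Matrix.one_apply_eq, Matrix.one_apply_ne (by decide : (0 : Fin 2) ≠ 1), Matrix.one_apply_ne (by decide : (1 : Fin 2) ≠ 0)]
  push_cast
  rw [Complex.normSq_eq_conj_mul_self]
  linear_combination ((c.1 : ℂ) * (c.2.2 : ℂ) - c.2.1 * conj c.2.1) * I_mul_I

/-- `|det(1 + ix)|² = 1 + a² + b² + 2|z|² + (|z|² − ab)²`. [folklore] -/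
theorem normSq_det_one_add_I_smul_hermTwo (c : ℝ × ℂ × ℝ) :
    normSq ((1 + I • hermTwo c).det) = 1 + c.1 ^ 2 + c.2.2 ^ 2 + 2 * normSq c.2.1 + (normSq c.2.1 - c.1 * c.2.2) ^ 2 := by
  rw [det_one_add_I_smul_hermTwo, Complex.normSq_apply]
  simp only [Complex.add_re, Complex.add_im, Complex.ofReal_re, Complex.ofReal_im, Complex.mul_re, Complex.mul_im, I_re, I_im, zero_mul,
    one_mul, mul_zero, sub_zero, zero_add, add_zero]
  ring

/-- `r ≤ |det(1 + ix)|` as soon as `r ≥ 0` and `r² ≤ |det(1 + ix)|²`. [folklore] -/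
theorem le_norm_det_of_sq_le {c : ℝ × ℂ × ℝ} {r : ℝ} (hr : 0 ≤ r) (h : r ^ 2 ≤ normSq ((1 + I • hermTwo c).det)) :
    r ≤ ‖(1 + I • hermTwo c).det‖ := by
  rw [← Real.sqrt_sq hr, Complex.norm_def]
  exact Real.sqrt_le_sqrt h

/-- `1 ≤ |det(1 + ix)|`. [folklore] -/
theorem one_le_norm_det (c : ℝ × ℂ × ℝ) : 1 ≤ ‖(1 + I • hermTwo c).det‖ := by
  refine le_norm_det_of_sq_le zero_le_one ?_
  rw [normSq_det_one_add_I_smul_hermTwo]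
  nlinarith [normSq_nonneg c.2.1, sq_nonneg c.1, sq_nonneg c.2.2, sq_nonneg (normSq c.2.1 - c.1 * c.2.2)]

/-- **every entry of `x` is bounded by `|det(1 + ix)|`**. [folklore] -/
theorem norm_hermTwo_apply_le_norm_det (c : ℝ × ℂ × ℝ) (j k : Fin 2) : ‖hermTwo c j k‖ ≤ ‖(1 + I • hermTwo c).det‖ := by
  have hsq := normSq_det_one_add_I_smul_hermTwo c
  have h0 := normSq_nonneg c.2.1
  have h1 := sq_nonneg (normSq c.2.1 - c.1 * c.2.2)
  fin_cases j <;> fin_cases k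
  · simp only [Fin.zero_eta, hermTwo_apply_zero_zero, Complex.norm_real, Real.norm_eq_abs]
    exact le_norm_det_of_sq_le (abs_nonneg _) (by rw [sq_abs, hsq]; nlinarith [sq_nonneg c.2.2])
  · simp only [Fin.zero_eta, Fin.mk_one, hermTwo_apply_zero_one]
    exact le_norm_det_of_sq_le (norm_nonneg _) (by rw [← Complex.normSq_eq_norm_sq, hsq]; nlinarith [sq_nonneg c.1, sq_nonneg c.2.2])
  · simp only [Fin.mk_one, Fin.zero_eta, hermTwo_apply_one_zero, Complex.norm_conj]
    exact le_norm_det_of_sq_le (norm_nonneg _) (by rw [← Complex.normSq_eq_norm_sq, hsq]; nlinarith [sq_nonneg c.1, sq_nonneg c.2.2])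
  · simp only [Fin.mk_one, hermTwo_apply_one_one, Complex.norm_real, Real.norm_eq_abs]
    exact le_norm_det_of_sq_le (abs_nonneg _) (by rw [sq_abs, hsq]; nlinarith [sq_nonneg c.1])

/-! ## §2 Polynomial weights are dominated by a power of `|det(1 + ix)|` -/

/-- a polynomial at a point whose coordinates are bounded by `N ≥ 1` is bounded by `‖P‖₁ · N^{deg P}`. [folklore] -/
theorem norm_eval_le {σ : Type*} (P : MvPolynomial σ ℂ) (v : σ → ℂ) {N : ℝ} (hN : 1 ≤ N) (hv : ∀ i, ‖v i‖ ≤ N) :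
    ‖MvPolynomial.eval v P‖ ≤ (∑ d ∈ P.support, ‖P.coeff d‖) * N ^ P.totalDegree := by
  rw [MvPolynomial.eval_eq, Finset.sum_mul]
  refine (norm_sum_le _ _).trans (Finset.sum_le_sum fun d hd => ?_)
  rw [norm_mul, norm_prod]
  refine mul_le_mul_of_nonneg_left ?_ (norm_nonneg _)
  calc ∏ i ∈ d.support, ‖v i ^ d i‖ ≤ ∏ i ∈ d.support, N ^ d i := by
        refine Finset.prod_le_prod (fun i _ => norm_nonneg _) fun i _ => ?_
        rw [norm_pow]
        exact pow_le_pow_left₀ (norm_nonneg _) (hv i) _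
    _ = N ^ (d.sum fun _ e => e) := by rw [Finset.prod_pow_eq_pow_sum]; rfl
    _ ≤ N ^ P.totalDegree := pow_le_pow_right₀ hN (MvPolynomial.le_totalDegree hd)

/-- **the weight bound**: `|P(x)| ≤ ‖P‖₁ · |det(1 + ix)|^{deg P}` on `Herm₂`. [folklore] -/
theorem norm_eval_hermTwo_le (P : MvPolynomial (Fin 2 × Fin 2) ℂ) (c : ℝ × ℂ × ℝ) :
    ‖MvPolynomial.eval (fun jk : Fin 2 × Fin 2 => hermTwo c jk.1 jk.2) P‖ ≤
      (∑ d ∈ P.support, ‖P.coeff d‖) * ‖(1 + I • hermTwo c).det‖ ^ P.totalDegree :=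
  norm_eval_le P _ (one_le_norm_det c) fun jk => norm_hermTwo_apply_le_norm_det c jk.1 jk.2

/-! ## §3 The `h`-line: hermitian along real `t`, and the `t`-derivative of the `ξ`-integrand -/

/-- `h + tΘ` is hermitian for hermitian `h, Θ` and real `t`. [folklore] -/
theorem isHermitian_add_real_smul {h Θ : Matrix (Fin 2) (Fin 2) ℂ} (hh : h.IsHermitian) (hΘ : Θ.IsHermitian) (t : ℝ) :
    (h + (t : ℂ) • Θ).IsHermitian := by
  unfold Matrix.IsHermitian at *
  rw [conjTranspose_add, conjTranspose_smul, hh, hΘ, Complex.star_def, Complex.conj_ofReal]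

/-- the trace against the line: `tr((h + tΘ) x) = tr(h x) + t·tr(Θ x)`. [folklore] -/
theorem trace_add_smul_mul (h Θ x : Matrix (Fin 2) (Fin 2) ℂ) (t : ℂ) : ((h + t • Θ) * x).trace = (h * x).trace + t * (Θ * x).trace := by
  rw [add_mul, Matrix.smul_mul, trace_add, trace_smul, smul_eq_mul]

/-- **the `t`-derivative of the `ξ`-integrand along the `h`-line** (real `t`): `∂_t ξ-integrand(1, h + tΘ) = −2πi·tr(Θx) · ξ-integrand(1, h + tΘ)`. [folklore] -/
theorem hasDerivAt_xiTwoIntegrand_hLine (h Θ : Matrix (Fin 2) (Fin 2) ℂ) (A B : ℂ) (c : ℝ × ℂ × ℝ) (t : ℝ) :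
    HasDerivAt (fun t : ℝ => xiTwoIntegrand 1 (h + (t : ℂ) • Θ) A B c)
      (-(2 * Real.pi * I) * (Θ * hermTwo c).trace * xiTwoIntegrand 1 (h + (t : ℂ) • Θ) A B c) t := by
  -- the complex-parameter version, then restriction to real `t`
  have hlin : HasDerivAt (fun τ : ℂ => -(2 * Real.pi * I) * ((h * hermTwo c).trace + τ * (Θ * hermTwo c).trace))
      (-(2 * Real.pi * I) * (Θ * hermTwo c).trace) (t : ℂ) := by
    have := ((hasDerivAt_id (t : ℂ)).mul_const ((Θ * hermTwo c).trace)).const_add ((h * hermTwo c).trace)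
    simpa using this.const_mul (-(2 * Real.pi * I))
  have hexp := (Complex.hasDerivAt_exp _).comp (t : ℂ) hlin
  have hC : HasDerivAt (fun τ : ℂ => cexp (-(2 * Real.pi * I) * ((h * hermTwo c).trace + τ * (Θ * hermTwo c).trace)) *
      ((cexp (-(Real.pi * I) * A) * (1 - I • hermTwo c).det ^ (-A)) * (cexp ((Real.pi * I) * B) * (1 + I • hermTwo c).det ^ (-B))))
      (cexp (-(2 * Real.pi * I) * ((h * hermTwo c).trace + t * (Θ * hermTwo c).trace)) * (-(2 * Real.pi * I) * (Θ * hermTwo c).trace) *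
        ((cexp (-(Real.pi * I) * A) * (1 - I • hermTwo c).det ^ (-A)) * (cexp ((Real.pi * I) * B) * (1 + I • hermTwo c).det ^ (-B))))
      (t : ℂ) := hexp.mul_const _
  have hR := hC.comp_ofReal
  have hfun : (fun t : ℝ => xiTwoIntegrand 1 (h + (t : ℂ) • Θ) A B c) =
      fun t : ℝ => cexp (-(2 * Real.pi * I) * ((h * hermTwo c).trace + (t : ℂ) * (Θ * hermTwo c).trace)) *
        ((cexp (-(Real.pi * I) * A) * (1 - I • hermTwo c).det ^ (-A)) * (cexp ((Real.pi * I) * B) * (1 + I • hermTwo c).det ^ (-B))) := by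
    funext t
    rw [xiTwoIntegrand_apply, trace_add_smul_mul]
  rw [hfun]
  convert hR using 1
  rw [xiTwoIntegrand_apply, trace_add_smul_mul]
  ring

/-- the linear weight `−2πi·tr(Θ x)` as a polynomial in the entries: evaluation. [folklore] -/
theorem eval_traceForm (Θ : Matrix (Fin 2) (Fin 2) ℂ) (c : ℝ × ℂ × ℝ) :
    MvPolynomial.eval (fun jk : Fin 2 × Fin 2 => hermTwo c jk.1 jk.2)
        (MvPolynomial.C (-(2 * Real.pi * I)) * ∑ jk : Fin 2 × Fin 2, MvPolynomial.C (Θ jk.2 jk.1) * MvPolynomial.X jk) =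
      -(2 * Real.pi * I) * (Θ * hermTwo c).trace := by
  simp only [Fintype.sum_prod_type, Fin.sum_univ_two, map_mul, map_add, MvPolynomial.eval_C, MvPolynomial.eval_X, Matrix.trace_fin_two,
    Matrix.mul_apply]
  ring

/-- … and its total degree is `≤ 1`. [folklore] -/
theorem totalDegree_traceForm_le (Θ : Matrix (Fin 2) (Fin 2) ℂ) :
    (MvPolynomial.C (-(2 * Real.pi * I)) * ∑ jk : Fin 2 × Fin 2, MvPolynomial.C (Θ jk.2 jk.1) * MvPolynomial.X jk :
      MvPolynomial (Fin 2 × Fin 2) ℂ).totalDegree ≤ 1 := by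
  refine (MvPolynomial.totalDegree_mul _ _).trans ?_
  rw [MvPolynomial.totalDegree_C, zero_add]
  refine (MvPolynomial.totalDegree_finsetSum _ _).trans (Finset.sup_le fun jk _ => ?_)
  refine (MvPolynomial.totalDegree_mul _ _).trans ?_
  rw [MvPolynomial.totalDegree_C, zero_add]
  exact (MvPolynomial.totalDegree_X (R := ℂ) jk).le

/-! ## §4 Moments are differentiable along the `h`-line, with derivative the next moment -/

/-- the moment integrand is a.e.-strongly measurable. [folklore] -/
theorem aestronglyMeasurable_moment (P : MvPolynomial (Fin 2 × Fin 2) ℂ) (g h : Matrix (Fin 2) (Fin 2) ℂ) (A B : ℂ) :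
    AEStronglyMeasurable (fun c : ℝ × ℂ × ℝ =>
      MvPolynomial.eval (fun jk : Fin 2 × Fin 2 => hermTwo c jk.1 jk.2) P * xiTwoIntegrand g h A B c) volume := by
  refine (Continuous.aestronglyMeasurable ?_).mul (aestronglyMeasurable_xiTwoIntegrand g h A B)
  have hc : Continuous fun c : ℝ × ℂ × ℝ => fun jk : Fin 2 × Fin 2 => hermTwo c jk.1 jk.2 := by
    refine continuous_pi fun jk => ?_
    rcases jk with ⟨j, k⟩
    fin_cases j <;> fin_cases k <;>
      simp only [Fin.zero_eta, Fin.mk_one, Fin.isValue, hermTwo_apply_zero_zero, hermTwo_apply_zero_one, hermTwo_apply_one_zero,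
        hermTwo_apply_one_one] <;> fun_prop
  exact (MvPolynomial.continuous_eval (p := P)).comp hc

/-- **the moment integrand is dominated**: `|P(x)·ξ-integrand(1, h; A, B)(x)| ≤ ‖P‖₁ e^{2π(|im A|+|im B|)} · |det(1+ix)|^{−(re(A+B) − deg P)}`
for hermitian `h`. [folklore] -/
theorem norm_moment_le (P : MvPolynomial (Fin 2 × Fin 2) ℂ) {h : Matrix (Fin 2) (Fin 2) ℂ} (hh : h.IsHermitian) (A B : ℂ) (c : ℝ × ℂ × ℝ) :
    ‖MvPolynomial.eval (fun jk : Fin 2 × Fin 2 => hermTwo c jk.1 jk.2) P * xiTwoIntegrand 1 h A B c‖ ≤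
      ((∑ d ∈ P.support, ‖P.coeff d‖) * Real.exp (2 * Real.pi * (|A.im| + |B.im|))) *
        ‖(1 + I • hermTwo c).det‖ ^ (-((A + B).re - P.totalDegree)) := by
  have hN : 0 < ‖(1 + I • hermTwo c).det‖ := lt_of_lt_of_le one_pos (one_le_norm_det c)
  rw [norm_mul, neg_sub, Real.rpow_sub hN, Real.rpow_natCast, div_eq_mul_inv, ← Real.rpow_neg hN.le]
  calc ‖MvPolynomial.eval (fun jk : Fin 2 × Fin 2 => hermTwo c jk.1 jk.2) P‖ * ‖xiTwoIntegrand 1 h A B c‖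
      ≤ ((∑ d ∈ P.support, ‖P.coeff d‖) * ‖(1 + I • hermTwo c).det‖ ^ P.totalDegree) *
          (Real.exp (2 * Real.pi * (|A.im| + |B.im|)) * ‖(1 + I • hermTwo c).det‖ ^ (-(A + B).re)) :=
        mul_le_mul (norm_eval_hermTwo_le P c) (norm_xiTwoIntegrand_le PosDef.one hh A B c) (norm_nonneg _)
          (mul_nonneg (Finset.sum_nonneg fun _ _ => norm_nonneg _) (pow_nonneg hN.le _))
    _ = _ := by ring

/-- **integrability of the moments**: for hermitian `h` and `re(A + B) > 3 + deg P`. [folklore] -/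
theorem integrable_moment (P : MvPolynomial (Fin 2 × Fin 2) ℂ) {h : Matrix (Fin 2) (Fin 2) ℂ} (hh : h.IsHermitian) {A B : ℂ}
    (hAB : 3 + (P.totalDegree : ℝ) < (A + B).re) :
    Integrable (fun c : ℝ × ℂ × ℝ => MvPolynomial.eval (fun jk : Fin 2 × Fin 2 => hermTwo c jk.1 jk.2) P * xiTwoIntegrand 1 h A B c) := by
  refine Integrable.mono' ((integrable_norm_det_add_I_smul_rpow_neg PosDef.one (σ := (A + B).re - P.totalDegree) (by linarith)).const_mul _)
    (aestronglyMeasurable_moment P 1 h A B) (Filter.Eventually.of_forall fun c => norm_moment_le P hh A B c)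

/-- **MOMENTS ARE DIFFERENTIABLE ALONG THE REAL `h`-LINE, THE DERIVATIVE BEING THE NEXT MOMENT.**  For hermitian `h, Θ`, a weight `P` and
`re(A + B) > 4 + deg P`:  `d∕dt ∫ P(x)·ξ-integrand(1, h + tΘ; A, B)(x) dx = ∫ P(x)·(−2πi tr(Θx))·ξ-integrand(1, h + tΘ; A, B)(x) dx`.
[cite: Shimura1997, §16.4] -/
theorem hasDerivAt_moment (P : MvPolynomial (Fin 2 × Fin 2) ℂ) {h Θ : Matrix (Fin 2) (Fin 2) ℂ} (hh : h.IsHermitian) (hΘ : Θ.IsHermitian)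
    {A B : ℂ} (hAB : 4 + (P.totalDegree : ℝ) < (A + B).re) (t₀ : ℝ) :
    HasDerivAt (fun t : ℝ => ∫ c : ℝ × ℂ × ℝ,
        MvPolynomial.eval (fun jk : Fin 2 × Fin 2 => hermTwo c jk.1 jk.2) P * xiTwoIntegrand 1 (h + (t : ℂ) • Θ) A B c)
      (∫ c : ℝ × ℂ × ℝ, MvPolynomial.eval (fun jk : Fin 2 × Fin 2 => hermTwo c jk.1 jk.2) P *
        (-(2 * Real.pi * I) * (Θ * hermTwo c).trace) * xiTwoIntegrand 1 (h + (t₀ : ℂ) • Θ) A B c) t₀ := by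
  -- the weight `P · (−2πi tr(Θx))` is again a polynomial, of degree `≤ deg P + 1`
  set L : MvPolynomial (Fin 2 × Fin 2) ℂ :=
    MvPolynomial.C (-(2 * Real.pi * I)) * ∑ jk : Fin 2 × Fin 2, MvPolynomial.C (Θ jk.2 jk.1) * MvPolynomial.X jk with hL
  have hLeval : ∀ c : ℝ × ℂ × ℝ, MvPolynomial.eval (fun jk : Fin 2 × Fin 2 => hermTwo c jk.1 jk.2) L = -(2 * Real.pi * I) * (Θ * hermTwo c).trace :=
    fun c => by rw [hL]; exact eval_traceForm Θ c
  have hLdeg : L.totalDegree ≤ 1 := by rw [hL]; exact totalDegree_traceForm_le Θ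
  have hPL : (P * L).totalDegree ≤ P.totalDegree + 1 := (MvPolynomial.totalDegree_mul _ _).trans (Nat.add_le_add_left hLdeg _)
  -- dominated differentiation on the ball of radius 1
  have key := hasDerivAt_integral_of_dominated_loc_of_deriv_le (μ := (volume : Measure (ℝ × ℂ × ℝ))) (x₀ := t₀)
    (F := fun t : ℝ => fun c : ℝ × ℂ × ℝ =>
      MvPolynomial.eval (fun jk : Fin 2 × Fin 2 => hermTwo c jk.1 jk.2) P * xiTwoIntegrand 1 (h + (t : ℂ) • Θ) A B c)
    (F' := fun t : ℝ => fun c : ℝ × ℂ × ℝ => MvPolynomial.eval (fun jk : Fin 2 × Fin 2 => hermTwo c jk.1 jk.2) P *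
        (-(2 * Real.pi * I) * (Θ * hermTwo c).trace) * xiTwoIntegrand 1 (h + (t : ℂ) • Θ) A B c)
    (bound := fun c : ℝ × ℂ × ℝ => ((∑ d ∈ (P * L).support, ‖(P * L).coeff d‖) * Real.exp (2 * Real.pi * (|A.im| + |B.im|))) *
        ‖(1 + I • hermTwo c).det‖ ^ (-((A + B).re - (P.totalDegree + 1 : ℕ))))
    (Metric.ball_mem_nhds t₀ one_pos) ?_ ?_ ?_ ?_ ?_ ?_
  · exact key.2
  · exact Filter.Eventually.of_forall fun t => aestronglyMeasurable_moment P 1 _ A B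
  · exact integrable_moment P (isHermitian_add_real_smul hh hΘ t₀) (by linarith)
  · have := aestronglyMeasurable_moment (P * L) 1 (h + (t₀ : ℂ) • Θ) A B
    refine this.congr (Filter.Eventually.of_forall fun c => ?_)
    simp only [map_mul, hLeval]
  · refine Filter.Eventually.of_forall fun c t _ => ?_
    have hmom := norm_moment_le (P * L) (isHermitian_add_real_smul hh hΘ t) A B c
    rw [map_mul, hLeval] at hmom
    refine hmom.trans (mul_le_mul_of_nonneg_left ?_ (mul_nonneg (Finset.sum_nonneg fun _ _ => norm_nonneg _) (Real.exp_pos _).le))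
    exact Real.rpow_le_rpow_of_exponent_le (one_le_norm_det c) (by simp only [neg_sub, sub_le_sub_iff_right, Nat.cast_add, Nat.cast_one]; exact_mod_cast hPL)
  · exact (integrable_norm_det_add_I_smul_rpow_neg PosDef.one (σ := (A + B).re - (P.totalDegree + 1 : ℕ)) (by push_cast; linarith)).const_mul _
  · refine Filter.Eventually.of_forall fun c t _ => ?_
    have := (hasDerivAt_xiTwoIntegrand_hLine h Θ A B c t).const_mul (MvPolynomial.eval (fun jk : Fin 2 × Fin 2 => hermTwo c jk.1 jk.2) P)
    simpa only [mul_assoc] using this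

/-! ## §5 Iteration: the `n`-th derivative is the `n`-th moment -/

/-- **THE `n`-TH REAL `h`-LINE DERIVATIVE OF A MOMENT IS THE MOMENT WITH WEIGHT `P·(−2πi tr(Θx))^n`** (hermitian `h, Θ`,
`re(A + B) > 3 + deg P + n`). [cite: Shimura1997, §16.4] -/
theorem iteratedDeriv_moment {h Θ : Matrix (Fin 2) (Fin 2) ℂ} (hh : h.IsHermitian) (hΘ : Θ.IsHermitian) {A B : ℂ} (n : ℕ) :
    ∀ (P : MvPolynomial (Fin 2 × Fin 2) ℂ), 3 + (P.totalDegree : ℝ) + n < (A + B).re → ∀ t₀ : ℝ,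
      iteratedDeriv n (fun t : ℝ => ∫ c : ℝ × ℂ × ℝ,
          MvPolynomial.eval (fun jk : Fin 2 × Fin 2 => hermTwo c jk.1 jk.2) P * xiTwoIntegrand 1 (h + (t : ℂ) • Θ) A B c) t₀ =
        ∫ c : ℝ × ℂ × ℝ, MvPolynomial.eval (fun jk : Fin 2 × Fin 2 => hermTwo c jk.1 jk.2) P *
          (-(2 * Real.pi * I) * (Θ * hermTwo c).trace) ^ n * xiTwoIntegrand 1 (h + (t₀ : ℂ) • Θ) A B c := by
  induction n with
  | zero =>
    intro P _ t₀
    simp only [iteratedDeriv_zero, pow_zero, mul_one]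
  | succ n ih =>
    intro P hP t₀
    set L : MvPolynomial (Fin 2 × Fin 2) ℂ :=
      MvPolynomial.C (-(2 * Real.pi * I)) * ∑ jk : Fin 2 × Fin 2, MvPolynomial.C (Θ jk.2 jk.1) * MvPolynomial.X jk with hL
    have hLeval : ∀ c : ℝ × ℂ × ℝ, MvPolynomial.eval (fun jk : Fin 2 × Fin 2 => hermTwo c jk.1 jk.2) L = -(2 * Real.pi * I) * (Θ * hermTwo c).trace :=
      fun c => by rw [hL]; exact eval_traceForm Θ c
    have hPL : ((P * L).totalDegree : ℝ) ≤ P.totalDegree + 1 := by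
      have h1 : (P * L).totalDegree ≤ P.totalDegree + 1 :=
        (MvPolynomial.totalDegree_mul _ _).trans (Nat.add_le_add_left (by rw [hL]; exact totalDegree_traceForm_le Θ) _)
      exact_mod_cast h1
    have hderiv : deriv (fun t : ℝ => ∫ c : ℝ × ℂ × ℝ,
          MvPolynomial.eval (fun jk : Fin 2 × Fin 2 => hermTwo c jk.1 jk.2) P * xiTwoIntegrand 1 (h + (t : ℂ) • Θ) A B c) =
        fun t : ℝ => ∫ c : ℝ × ℂ × ℝ,
          MvPolynomial.eval (fun jk : Fin 2 × Fin 2 => hermTwo c jk.1 jk.2) (P * L) * xiTwoIntegrand 1 (h + (t : ℂ) • Θ) A B c := by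
      funext t
      rw [(hasDerivAt_moment P hh hΘ (by push_cast at hP; linarith) t).deriv]
      congr 1
      funext c
      rw [map_mul, hLeval]
    push_cast at hP
    rw [iteratedDeriv_succ', hderiv, ih (P * L) (by linarith) t₀]
    congr 1
    funext c
    rw [map_mul, hLeval, pow_succ]
    ring

/-- **THE `n`-TH REAL `h`-LINE DERIVATIVE OF `ξ(1, ·; A, B)` IS THE `n`-TH MOMENT**: for hermitian `h, Θ` and `re(A + B) > 3 + n`,
`(d∕dt)^n|_{t₀} ξ(1, h + tΘ; A, B) = ∫ (−2πi·tr(Θ x))^n · ξ-integrand(1, h + t₀Θ; A, B)(x) dx`. [cite: Shimura1997, §16.4] -/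
theorem iteratedDeriv_xiTwo_hLine {h Θ : Matrix (Fin 2) (Fin 2) ℂ} (hh : h.IsHermitian) (hΘ : Θ.IsHermitian) {A B : ℂ} (n : ℕ)
    (hAB : 3 + (n : ℝ) < (A + B).re) (t₀ : ℝ) :
    iteratedDeriv n (fun t : ℝ => xiTwo 1 (h + (t : ℂ) • Θ) A B) t₀ =
      ∫ c : ℝ × ℂ × ℝ, (-(2 * Real.pi * I) * (Θ * hermTwo c).trace) ^ n * xiTwoIntegrand 1 (h + (t₀ : ℂ) • Θ) A B c := by
  have h1 := iteratedDeriv_moment hh hΘ (A := A) (B := B) n 1 (by rw [MvPolynomial.totalDegree_one]; push_cast; linarith) t₀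
  simp only [map_one, one_mul] at h1
  rw [← h1]
  rfl

end Summit.HodgeConjecture.HodgeConjecture.Cruxes.HLiu418.K2LiuXiTwoMomentsAsHDerivatives

end
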